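import Summits.RiemannHypothesis.RiemannHypothesis.Theorems.PfPersistenceFfWeilCriterionSharpQ4All
import Summits.RiemannHypothesis.RiemannHypothesis.Theorems.MotivicDoorFfRealLattice

/-!
# Function-field mirror: sharpness of the positivity depth at EVERY `q ≥ 2` — the small genera `g ≤ 3`
(pub-rhpf, seat ffmirror-2 gen 8; HONEST FRAMING: mechanism/rigidity campaign — no RH claims)

Door D-D of the cell: for an FE-honest datum `(q, h)`, `deg h = 2g`, the one window form `T_{2g-1}(q, h)` decides
the function-field RH of the datum (`PfPersistenceFfWeilCriterion`, `4f1b3da6ffbf`), and the depth `2g - 1` is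
sharp — for every `g` at SOME `q` growing with `g` (`positivityDepth_sharp`, `PfPersistenceFfWeilCriterionSharpAll`)
and for every `g` at the ONE prime power `q = 4` (`positivityDepth_sharp_q4`, `PfPersistenceFfWeilCriterionSharpQ4All`).
The riders left open there (ESCAPE-DOORS v1.17 door D-D, R1′/R1″: odd prime powers `q = p^{2k+1}`, in particular
`q = 2`, and `q = p²` for odd `p`) ask for sharpness at an ARBITRARY fixed `q`.

THIS FILE and its sequel `PfPersistenceFfWeilCriterionSharpAllQThree` (split only for length): the small genera
`g = 1, 2, 3` at EVERY natural `q ≥ 2`, SYMBOLICALLY IN `q` (no root is computed, no numerical certificate is used);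
here `g = 1, 2` and the generic sign-change lemma, there `g = 3` and the assembly over `g ≤ 3`:
* `g = 1`: `h₁(q) = x² - (q+1)x + q = (x - 1)(x - q)`;
* `g = 2`: `h₂(q) = x⁴ - x³ - (2q-2)x² - qx + q²`, power sums `s_1, s_2 = 1, 4q - 3` (two Newton steps), and the
  real lattice window `S_2 = (q^{min(m,m')} s_{|m-m'|})_{m,m' ≤ 2}` (`MotivicDoorFfRealLattice.realLattice`, the
  integer form `D (2T_2) D` of the window form) is a nonnegative form by the explicit weighted sum of squares
  `4(16q-1)·cᵀS_2c = (16q-1)(4c_0 + c_1 + (4q-3)c_2)² + ((16q-1)c_1 + 3c_2)² + 4(96q²-42q)c_2²`;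
* `g = 3` (sequel): `h₃(q) = x⁶ - x⁵ - (q-1)x⁴ - q(q-1)x² - q²x + q³`, four Newton steps and a fraction-free `LDLᵀ`
  identity for `S_4`;
* in each case `h_g(√q) = 2q^{⌈g/2⌉}(1 - √q) < 0 ≤ h_g(q)`, so a real root lies in `(√q, q]`, off the circle
  `|α| = √q`: the function-field RH FAILS for the datum, and the window of depth `2g - 1` is not positive
  semidefinite by the criterion; the coefficient functional equation `q^g c_j = q^i c_i` (`i + j = 2g`) holds.
* `sharp_witness_allq_one`, `sharp_witness_allq_two`: the sharpness conjunction (monic, root-reciprocal, `0 ∉ roots`,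
  degree `2g`, RH-false, depth `2g - 2` PSD, depth `2g - 1` not) at `g = 1, 2` for every `q ≥ 2`; the sequel assembles
  `positivityDepth_sharp_allq_le_three` in the exact shape of `positivityDepth_sharp_q4`, now with `q` free.
These three polynomials are the members `g ≤ 3` of ONE integer family `h = x^{2g-D} B_D(x) + q^{g-D} x^D B_D(q/x)`,
`D = 2⌊g/2⌋`, `B_D = x^{D-2}(x² - q) - x + 1`, whose members `g ≥ 4` are treated in sequel files; nothing here is a
statement about `ζ`, and 'RH' always means the function-field statement `∀ α ∈ frobRoots h, ‖α‖ = √q` for the one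
datum at hand.  All [folklore]: explicit algebra (Newton's identities, Sylvester/`LDLᵀ`), new only as kernel-checked
statements binding BY NAME to `weilWindowForm`.
-/

set_option linter.dupNamespace false  -- the mandated namespace repeats `RiemannHypothesis`

noncomputable section

open Polynomial Matrix Finset
open scoped ComplexOrder ComplexConjugate
open Summit.RiemannHypothesis.RiemannHypothesis.Theorems.MotivicDoor.FfRealLattice
  (realLattice realLattice_nonneg_iff_posSemidef)

namespace Summit.RiemannHypothesis.RiemannHypothesis.Theorems.PfPersistence.FfAngleTwin

/-! ## A real root beyond `√q` from a sign change (no root formula) -/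

/-- If the integer polynomial `h` (read over `ℝ`) is negative at `√q` and nonnegative at some `b ≥ √q`, then `h`
has a complex root `α` with `‖α‖ ≠ √q` — a real root `x ∈ (√q, b]`, by the intermediate value theorem. [folklore] -/
theorem exists_offCircle_of_eval_sqrt_neg {q : ℕ} {h : ℤ[X]} (hm : h.Monic) {b : ℝ}
    (hb : Real.sqrt q ≤ b) (hneg : (h.map (Int.castRingHom ℝ)).eval (Real.sqrt q) < 0)
    (hpos : 0 ≤ (h.map (Int.castRingHom ℝ)).eval b) :
    ∃ α ∈ frobRoots h, ‖α‖ ≠ Real.sqrt q := by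
  set f : ℝ → ℝ := fun x => (h.map (Int.castRingHom ℝ)).eval x with hf
  have hcont : ContinuousOn f (Set.Icc (Real.sqrt q) b) := (Polynomial.continuous _).continuousOn
  obtain ⟨x, hx, hfx⟩ := intermediate_value_Icc hb hcont ⟨hneg.le, hpos⟩
  have hxne : x ≠ Real.sqrt q := by
    rintro rfl
    exact absurd hfx (ne_of_lt hneg)
  have hxgt : Real.sqrt q < x := lt_of_le_of_ne hx.1 (Ne.symm hxne)
  have hxpos : 0 < x := lt_of_le_of_lt (Real.sqrt_nonneg _) hxgt
  refine ⟨(x : ℂ), ?_, ?_⟩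
  · have hne : h.map (Int.castRingHom ℂ) ≠ 0 := (hm.map _).ne_zero
    rw [frobRoots, mem_roots hne]
    have hmap : h.map (Int.castRingHom ℂ) = (h.map (Int.castRingHom ℝ)).map (algebraMap ℝ ℂ) := by
      rw [Polynomial.map_map]; congr 1
    rw [hmap]
    have hroot : (h.map (Int.castRingHom ℝ)).IsRoot x := hfx
    simpa using hroot.map (f := algebraMap ℝ ℂ)
  · rw [Complex.norm_real, Real.norm_eq_abs, abs_of_pos hxpos]
    exact ne_of_gt hxgt

/-- A `1 × 1` window `T_0 = (K(0)) = (deg h / 2)` is positive semidefinite. [folklore] -/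
theorem weilWindowForm_zero_posSemidef (q : ℝ) (h : ℤ[X]) : (weilWindowForm q h 0).PosSemidef := by
  rw [weilWindowForm]
  have hT : ffWindowForm q (frobRoots h) 0 = !![((Multiset.card (frobRoots h) : ℂ) / 2)] := by
    ext m m'
    fin_cases m; fin_cases m'
    simp [ffWindowForm, Nat.dist, ffKernel_zero]
  rw [hT]
  refine Matrix.PosSemidef.of_dotProduct_mulVec_nonneg ?_ fun x => ?_
  · refine Matrix.IsHermitian.ext fun i j => ?_
    fin_cases i; fin_cases j
    simp
  · have h1 := star_mul_self_nonneg (x 0)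
    simp only [Complex.star_def] at h1
    have key : star x ⬝ᵥ (!![((Multiset.card (frobRoots h) : ℂ) / 2)] *ᵥ x)
        = (Multiset.card (frobRoots h) : ℂ) / 2 * (conj (x 0) * x 0) := by
      simp [dotProduct, Matrix.mulVec]; ring
    rw [key]
    have hc : (0 : ℂ) ≤ (Multiset.card (frobRoots h) : ℂ) / 2 := by
      have e : (((Multiset.card (frobRoots h) : ℝ) / 2 : ℝ) : ℂ) = (Multiset.card (frobRoots h) : ℂ) / 2 := by
        push_cast; ring
      rw [← e]; exact Complex.zero_le_real.2 (by positivity)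
    exact mul_nonneg hc h1

/-! ## `g = 1`: `h₁(q) = x² - (q+1)x + q = (x - 1)(x - q)` -/

/-- The `g = 1` member: `h₁(q) = x² - (q+1)x + q`. [folklore] -/
def hAQ1 (q : ℕ) : ℤ[X] := X ^ 2 - C ((q : ℤ) + 1) * X + C (q : ℤ)

/-- Coefficients of `h₁(q)`. [folklore] -/
theorem coeff_hAQ1 (q j : ℕ) : (hAQ1 q).coeff j =
    (if j = 2 then 1 else 0) - (if j = 1 then ((q : ℤ) + 1) else 0) + (if j = 0 then (q : ℤ) else 0) := by
  simp only [hAQ1, coeff_add, coeff_sub, coeff_X_pow, coeff_C_mul, coeff_X, coeff_C, mul_ite, mul_one,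
    mul_zero]
  congr 2
  first | rfl | (split_ifs <;> first | rfl | omega)

/-- `h₁(q)` is monic. [folklore] -/
theorem hAQ1_monic (q : ℕ) : (hAQ1 q).Monic := by
  unfold hAQ1; monicity <;> norm_num

/-- `deg h₁(q) = 2`. [folklore] -/
theorem natDegree_hAQ1 (q : ℕ) : (hAQ1 q).natDegree = 2 := by
  unfold hAQ1; compute_degree <;> norm_num

/-- Coefficient functional equation of `h₁(q)` (`g = 1`). [folklore] -/
theorem hAQ1_fe (q : ℕ) : ∀ i j, i + j = 2 * 1 → (q : ℤ) ^ 1 * (hAQ1 q).coeff j = (q : ℤ) ^ i * (hAQ1 q).coeff i := by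
  intro i j hij
  have hi : i ≤ 2 := by omega
  interval_cases i
  · obtain rfl : j = 2 := by omega
    simp [coeff_hAQ1]
  · obtain rfl : j = 1 := by omega
    simp [coeff_hAQ1]
  · obtain rfl : j = 0 := by omega
    simp [coeff_hAQ1]; ring

/-- `h₁(q)(√q) = 2q - (q+1)√q`, `h₁(q)(q) = 0`; for `q ≥ 2`, `1` is a root off the circle.  We use the sign route:
`h₁(√q) = √q (2√q - q - 1) = -√q (√q - 1)² < 0` for `q ≥ 2`, `h₁(q) = 0`. [folklore] -/
theorem exists_offCircle_hAQ1 (q : ℕ) (hq : 2 ≤ q) : ∃ α ∈ frobRoots (hAQ1 q), ‖α‖ ≠ Real.sqrt q := by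
  have hqr : (2 : ℝ) ≤ q := by exact_mod_cast hq
  have hs : Real.sqrt q * Real.sqrt q = q := Real.mul_self_sqrt (by positivity)
  have hs1 : 1 < Real.sqrt q := by
    rw [show (1 : ℝ) = Real.sqrt 1 by simp]
    exact Real.sqrt_lt_sqrt (by norm_num) (by linarith)
  have hev : ∀ x : ℝ, ((hAQ1 q).map (Int.castRingHom ℝ)).eval x = x ^ 2 - ((q : ℝ) + 1) * x + q := by
    intro x
    simp only [hAQ1, eval_map, eval₂_add, eval₂_sub, eval₂_mul, eval₂_X_pow, eval₂_C, eval₂_X]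
    simp only [eq_intCast, Int.cast_add, Int.cast_natCast, Int.cast_one]
  refine exists_offCircle_of_eval_sqrt_neg (hAQ1_monic q) (b := q) ?_ ?_ ?_
  · have h1 : Real.sqrt q * 1 ≤ Real.sqrt q * Real.sqrt q :=
      mul_le_mul_of_nonneg_left hs1.le (Real.sqrt_nonneg _)
    rw [mul_one, hs] at h1
    exact h1
  · rw [hev]; nlinarith
  · rw [hev]; nlinarith

/-- SHARPNESS WITNESS AT `g = 1`, every `q ≥ 2`. [folklore] -/
theorem sharp_witness_allq_one (q : ℕ) (hq : 2 ≤ q) :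
    (hAQ1 q).Monic ∧
    (frobRoots (hAQ1 q)).map (fun α => ((q : ℝ) : ℂ) / α) = frobRoots (hAQ1 q) ∧
    (0 : ℂ) ∉ frobRoots (hAQ1 q) ∧ (hAQ1 q).natDegree = 2 * 1 ∧
    ¬ (∀ α ∈ frobRoots (hAQ1 q), ‖α‖ = Real.sqrt q) ∧
    (weilWindowForm q (hAQ1 q) 0).PosSemidef ∧ ¬ (weilWindowForm q (hAQ1 q) 1).PosSemidef := by
  have hq0 : 0 < q := by omega
  have hdeg : (hAQ1 q).natDegree = 2 * 1 := natDegree_hAQ1 q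
  have hrec := frobRoots_map_div_of_fe_real hq0 hdeg (hAQ1_fe q)
  have h0 := zero_not_mem_frobRoots_of_fe hq0 hdeg (hAQ1_fe q)
  have hoff := exists_offCircle_hAQ1 q hq
  refine ⟨hAQ1_monic q, by simpa using hrec, h0, hdeg, ?_, weilWindowForm_zero_posSemidef _ _, ?_⟩
  · intro hall; obtain ⟨α, hα, hne⟩ := hoff; exact hne (hall α hα)
  · exact weilWindowForm_not_posSemidef_of_fe_offCircle hq0 hdeg (hAQ1_fe q) hoff (by norm_num)

/-! ## `g = 2`: `h₂(q) = x⁴ - x³ - (2q-2)x² - qx + q²` -/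

/-- The `g = 2` member: `h₂(q) = x⁴ - x³ - (2q-2)x² - qx + q²` (`= x²B_2(x) + B_2^*(x)`, `B_2 = x² - x + 1 - q`).
[folklore] -/
def hAQ2 (q : ℕ) : ℤ[X] :=
  X ^ 4 - X ^ 3 - C (2 * (q : ℤ) - 2) * X ^ 2 - C (q : ℤ) * X + C ((q : ℤ) ^ 2)

/-- Coefficients of `h₂(q)`. [folklore] -/
theorem coeff_hAQ2 (q j : ℕ) : (hAQ2 q).coeff j =
    (if j = 4 then 1 else 0) - (if j = 3 then 1 else 0) - (if j = 2 then (2 * (q : ℤ) - 2) else 0)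
      - (if j = 1 then (q : ℤ) else 0) + (if j = 0 then (q : ℤ) ^ 2 else 0) := by
  simp only [hAQ2, coeff_add, coeff_sub, coeff_X_pow, coeff_C_mul, coeff_X, coeff_C, mul_ite, mul_one,
    mul_zero]
  congr 2
  first | rfl | (split_ifs <;> first | rfl | omega)

/-- `h₂(q)` is monic. [folklore] -/
theorem hAQ2_monic (q : ℕ) : (hAQ2 q).Monic := by
  unfold hAQ2; monicity <;> norm_num

/-- `deg h₂(q) = 4`. [folklore] -/
theorem natDegree_hAQ2 (q : ℕ) : (hAQ2 q).natDegree = 2 * 2 := by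
  unfold hAQ2; compute_degree <;> norm_num

/-- Coefficient functional equation of `h₂(q)` (`g = 2`): `q² c_j = q^i c_i` for `i + j = 4`. [folklore] -/
theorem hAQ2_fe (q : ℕ) :
    ∀ i j, i + j = 2 * 2 → (q : ℤ) ^ 2 * (hAQ2 q).coeff j = (q : ℤ) ^ i * (hAQ2 q).coeff i := by
  intro i j hij
  have hi : i ≤ 4 := by omega
  interval_cases i
  · obtain rfl : j = 4 := by omega
    simp [coeff_hAQ2]
  · obtain rfl : j = 3 := by omega
    simp [coeff_hAQ2]; ring
  · obtain rfl : j = 2 := by omega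
    simp [coeff_hAQ2]
  · obtain rfl : j = 1 := by omega
    simp [coeff_hAQ2]; ring
  · obtain rfl : j = 0 := by omega
    simp [coeff_hAQ2]; ring

/-- `h₂(q)(√q) = 2q(1 - √q) < 0 ≤ q²(q-1)(q-2) = h₂(q)(q)` for `q ≥ 2`: a real root in `(√q, q]`, so the
function-field RH FAILS for `(q, h₂(q))`. [folklore] -/
theorem exists_offCircle_hAQ2 (q : ℕ) (hq : 2 ≤ q) : ∃ α ∈ frobRoots (hAQ2 q), ‖α‖ ≠ Real.sqrt q := by
  have hqr : (2 : ℝ) ≤ q := by exact_mod_cast hq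
  have hs : Real.sqrt q * Real.sqrt q = q := Real.mul_self_sqrt (by positivity)
  have hs1 : 1 < Real.sqrt q := by
    rw [show (1 : ℝ) = Real.sqrt 1 by simp]
    exact Real.sqrt_lt_sqrt (by norm_num) (by linarith)
  have hev : ∀ x : ℝ, ((hAQ2 q).map (Int.castRingHom ℝ)).eval x
      = x ^ 4 - x ^ 3 - (2 * (q : ℝ) - 2) * x ^ 2 - q * x + (q : ℝ) ^ 2 := by
    intro x
    simp only [hAQ2, eval_map, eval₂_add, eval₂_sub, eval₂_mul, eval₂_X_pow, eval₂_C, eval₂_X]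
    simp only [eq_intCast, Int.cast_sub, Int.cast_mul, Int.cast_pow, Int.cast_natCast, Int.cast_ofNat]
  refine exists_offCircle_of_eval_sqrt_neg (hAQ2_monic q) (b := q) ?_ ?_ ?_
  · have h1 : Real.sqrt q * 1 ≤ Real.sqrt q * Real.sqrt q :=
      mul_le_mul_of_nonneg_left hs1.le (Real.sqrt_nonneg _)
    rw [mul_one, hs] at h1
    exact h1
  · -- `h₂(√q) = 2q(1 - √q)`
    rw [hev]
    have h4 : Real.sqrt q ^ 4 = (q : ℝ) ^ 2 := by
      rw [show (4 : ℕ) = 2 * 2 from rfl, pow_mul, Real.sq_sqrt (by positivity)]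
    have h3 : Real.sqrt q ^ 3 = (q : ℝ) * Real.sqrt q := by
      rw [pow_succ, Real.sq_sqrt (by positivity)]
    have h2 : Real.sqrt q ^ 2 = (q : ℝ) := Real.sq_sqrt (by positivity)
    rw [h4, h3, h2]
    nlinarith
  · rw [hev]
    have : (q : ℝ) ^ 4 - (q : ℝ) ^ 3 - (2 * (q : ℝ) - 2) * (q : ℝ) ^ 2 - q * q + (q : ℝ) ^ 2
        = (q : ℝ) ^ 2 * ((q - 1) * (q - 2)) := by ring
    rw [this]
    exact mul_nonneg (by positivity) (mul_nonneg (by linarith) (by linarith))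

/-- Vieta for `h₂(q)`. [folklore] -/
theorem esymm_hAQ2 (q k : ℕ) (hk : k ≤ 4) :
    (frobRoots (hAQ2 q)).esymm k = (-1) ^ k * (((hAQ2 q).coeff (4 - k) : ℤ) : ℂ) := by
  have h := esymm_frobRoots (hAQ2_monic q) (k := k) (by rw [natDegree_hAQ2 q]; omega)
  rwa [natDegree_hAQ2 q] at h

/-- The power sums `s_1 = 1`, `s_2 = 4q - 3` of the roots of `h₂(q)`, by two Newton steps from `e_1 = 1`,
`e_2 = 2 - 2q` (no root is computed). [folklore] -/
theorem powerSum_hAQ2 (q : ℕ) :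
    powerSum (frobRoots (hAQ2 q)) 0 = 4 ∧ powerSum (frobRoots (hAQ2 q)) 1 = 1 ∧
    powerSum (frobRoots (hAQ2 q)) 2 = 4 * (q : ℂ) - 3 := by
  set A := frobRoots (hAQ2 q) with hA
  have s0 : powerSum A 0 = 4 := by
    have := ffKernel_zero 1 A
    rw [powerSum]
    simp only [pow_zero, Multiset.map_const', Multiset.sum_replicate, nsmul_eq_mul, mul_one]
    rw [hA, card_frobRoots_eq_natDegree, natDegree_hAQ2]; norm_num
  have e0 : A.esymm 0 = 1 := multiset_esymm_zero A
  have e1 : A.esymm 1 = 1 := by rw [esymm_hAQ2 q 1 (by norm_num), coeff_hAQ2]; norm_num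
  have e2 : A.esymm 2 = 2 - 2 * (q : ℂ) := by
    rw [esymm_hAQ2 q 2 (by norm_num), coeff_hAQ2]; norm_num
  have n1 := newton_range A 1
  have n2 := newton_range A 2
  simp only [sum_range_succ, sum_range_zero, zero_add, e0, e1, e2] at n1 n2
  norm_num at n1 n2
  have s1 : powerSum A 1 = 1 := by linear_combination -n1
  have s2 : powerSum A 2 = 4 * (q : ℂ) - 3 := by linear_combination n2 + s1
  exact ⟨s0, s1, s2⟩

/-- The real lattice window `S_2(q, h₂(q)) = (q^{min(m,m')} s_{|m-m'|})`:
`[[4, 1, 4q-3], [1, 4q, q], [4q-3, q, 4q²]]`. [folklore] -/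
theorem realLattice_hAQ2 (q : ℕ) :
    realLattice q (hAQ2 q) 2 = !![4, 1, 4 * (q : ℝ) - 3; 1, 4 * (q : ℝ), (q : ℝ); 4 * (q : ℝ) - 3, (q : ℝ), 4 * (q : ℝ) ^ 2] := by
  obtain ⟨s0, s1, s2⟩ := powerSum_hAQ2 q
  have r0 : (powerSum (frobRoots (hAQ2 q)) 0).re = 4 := by rw [s0]; norm_num
  have r1 : (powerSum (frobRoots (hAQ2 q)) 1).re = 1 := by rw [s1]; norm_num
  have r2 : (powerSum (frobRoots (hAQ2 q)) 2).re = 4 * (q : ℝ) - 3 := by rw [s2]; simp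
  ext m m'
  fin_cases m <;> fin_cases m' <;> simp [realLattice, Nat.dist, r0, r1, r2] <;> ring

/-- `S_2(q, h₂(q))` is a nonnegative form for `q ≥ 2` (indeed `q ≥ 1`): the weighted sum of squares
`4(16q-1)·cᵀS_2c = (16q-1)(4c_0 + c_1 + (4q-3)c_2)² + ((16q-1)c_1 + 3c_2)² + 4(96q²-42q)c_2²`. [folklore] -/
theorem realLattice_hAQ2_nonneg (q : ℕ) (hq : 2 ≤ q) (c : Fin 3 → ℝ) :
    0 ≤ c ⬝ᵥ (realLattice q (hAQ2 q) 2 *ᵥ c) := by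
  obtain ⟨r, hr, hqr⟩ : ∃ r : ℝ, 0 ≤ r ∧ (q : ℝ) = r + 2 :=
    ⟨(q : ℝ) - 2, by linarith [show (2 : ℝ) ≤ q by exact_mod_cast hq], by ring⟩
  have hQ : c ⬝ᵥ (realLattice q (hAQ2 q) 2 *ᵥ c)
      = 4 * c 0 ^ 2 + 4 * q * c 1 ^ 2 + 4 * (q : ℝ) ^ 2 * c 2 ^ 2 + 2 * c 0 * c 1
        + 2 * (4 * q - 3) * c 0 * c 2 + 2 * q * c 1 * c 2 := by
    rw [realLattice_hAQ2]
    simp [dotProduct, Matrix.mulVec, Fin.sum_univ_three]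
    ring
  have hW : 0 < (4 : ℝ) * (31 + 16 * r) := by positivity
  have key : (4 : ℝ) * (31 + 16 * r) * (c ⬝ᵥ (realLattice q (hAQ2 q) 2 *ᵥ c))
      = (31 + 16 * r) * (4 * c 0 + c 1 + (5 + 4 * r) * c 2) ^ 2
        + ((31 + 16 * r) * c 1 + 3 * c 2) ^ 2
        + 4 * (300 + 342 * r + 96 * r ^ 2) * (c 2) ^ 2 := by
    rw [hQ, hqr]; ring
  have hrhs : 0 ≤ (31 + 16 * r) * (4 * c 0 + c 1 + (5 + 4 * r) * c 2) ^ 2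
        + ((31 + 16 * r) * c 1 + 3 * c 2) ^ 2
        + 4 * (300 + 342 * r + 96 * r ^ 2) * (c 2) ^ 2 := by positivity
  rw [← key] at hrhs
  exact (mul_nonneg_iff_of_pos_left hW).1 hrhs

/-- `T_2(q, h₂(q)) ⪰ 0` for every `q ≥ 2` (window of depth `2g - 2 = 2`). [folklore] -/
theorem windowForm_hAQ2_posSemidef (q : ℕ) (hq : 2 ≤ q) : (weilWindowForm q (hAQ2 q) 2).PosSemidef :=
  (realLattice_nonneg_iff_posSemidef q (hAQ2 q) 2 (by omega)).1 (realLattice_hAQ2_nonneg q hq)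

/-- SHARPNESS WITNESS AT `g = 2`, every `q ≥ 2`. [folklore] -/
theorem sharp_witness_allq_two (q : ℕ) (hq : 2 ≤ q) :
    (hAQ2 q).Monic ∧
    (frobRoots (hAQ2 q)).map (fun α => ((q : ℝ) : ℂ) / α) = frobRoots (hAQ2 q) ∧
    (0 : ℂ) ∉ frobRoots (hAQ2 q) ∧ (hAQ2 q).natDegree = 2 * 2 ∧
    ¬ (∀ α ∈ frobRoots (hAQ2 q), ‖α‖ = Real.sqrt q) ∧
    (weilWindowForm q (hAQ2 q) 2).PosSemidef ∧ ¬ (weilWindowForm q (hAQ2 q) 3).PosSemidef := by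
  have hq0 : 0 < q := by omega
  have hdeg := natDegree_hAQ2 q
  have hrec := frobRoots_map_div_of_fe_real hq0 hdeg (hAQ2_fe q)
  have h0 := zero_not_mem_frobRoots_of_fe hq0 hdeg (hAQ2_fe q)
  have hoff := exists_offCircle_hAQ2 q hq
  refine ⟨hAQ2_monic q, by simpa using hrec, h0, hdeg, ?_, windowForm_hAQ2_posSemidef q hq, ?_⟩
  · intro hall; obtain ⟨α, hα, hne⟩ := hoff; exact hne (hall α hα)
  · exact weilWindowForm_not_posSemidef_of_fe_offCircle hq0 hdeg (hAQ2_fe q) hoff (by norm_num)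

end Summit.RiemannHypothesis.RiemannHypothesis.Theorems.PfPersistence.FfAngleTwin

end
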